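import Summits.HubbardSuperconductivity.HubbardSuperconductivity.Theorems.CwThesis.Negative.FreeEndpointCorollaries
import Summits.HubbardSuperconductivity.HubbardSuperconductivity.Theorems.ChiralWindowCwThesisReductions

/-!
# Crux `CwThesis` (item `stmt-HubbardSuperconductivity-10438`), line `SketchIdeator3`: the engine
`stub_gibbsPenaltyFloor` is FALSE at `U = 0` — `0 < U` is load-bearing for the penalty line too

Negative-side bookkeeping for the penalty line (the exact analogue of `RingTracesAtZero.lean` for line
`SketchIdeator2`). The ENGINE of line `SketchIdeator3` is the canonical Gibbs `d`-wave floor under an intensive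
pair penalty: for every weak `U` a window doping `δ_U` and constants `κ, a, M > 0`, `2 log 4 ≤ M κ a`, with,
eventually along `L = 2(k+1)`, `a L⁴ ≤ Re ω(Q_p)` for the Gibbs state at `β = M L²` of the penalised `(n,n)`-block
`H_p + (κ/L⁴) Q_p` (`H_p`, `Q_p` the compressions of `hubbardTorus 2 L 1 U` and `Δ_d†Δ_d`, `2n = N_L(δ_U)`).

* `penaltyResponseAt_zero_of_gibbsFloor` — at `U = 0`, Gibbs-penalty-floor constants at a doping `δ ≥ 0` give the
  eventual penalty response `(a/2)κ ≤ E_L(0;κ) - E_L(0;0)` (`penaltyResponse_of_gibbsFloor`: thermal descent +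
  block bookkeeping, word for word the skeleton's `chiralPenaltyResponse_of_stubs` at `U := 0`);
* `stub_engineFalseAtZero` — hence at `U = 0` NO doping `δ ≥ 0` carries Gibbs-penalty-floor constants: the
  response and `stub_penaltyResponseLRO 0 δ κ (a/2)` (`TorusCooperLog.PenaltyResponseLRO`, chord inequality) give
  the summit matrix at `(0, δ)` (= `HasDWavePairFieldLROAt 0 δ` by `Iff.rfl`), which
  `not_hasDWavePairFieldLROAt_zero` refutes (every free sector ground state has pair intensity `≤ 320 L²`);
* `gibbsPenaltyFloor_false_at_zero` — so the `U = 0` analogue of the engine (the window doping still free) is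
  false: `0 < U` is load-bearing for `stub_gibbsPenaltyFloor`, and like every constant of any proof of `CwThesis`
  (Disproof.lean §6/§7) its floor constant `a = a(U)` must degenerate as `U → 0⁺`.

Folklore; no definitions; nothing asserts a Theses declaration.
-/

noncomputable section

namespace Summit.HubbardSuperconductivity.CwThesis.Negative

-- `DecidableEq {s : Finset (Orb Λ) // …}` (the `(n,n)`-block index) exceeds the default instance size budget
set_option synthInstance.maxSize 512

open Literature.MathematicalPhysics.QuantumLattice Literature.Barriers.HubbardSuperconductivity
open Summit.HubbardSuperconductivity.HubbardSuperconductivity.Theorems.CwThesis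
open Set Matrix Filter

/-- **Engine ⇒ penalty response, at `U = 0`.** If at a doping `δ ≥ 0` constants `κ, M > 0`, `a` with
`2 log 4 ≤ M κ a` give, eventually along `L = 2(k+1)`, the Gibbs floor `a L⁴ ≤ Re ω(Q_p)` in the penalised
`(n,n)`-block ensemble of the FREE torus `hubbardTorus 2 L 1 0` at `β = M L²`, then eventually
`(a/2) κ ≤ E_L(0;κ) - E_L(0;0)` (`penaltyResponse_of_gibbsFloor`, as in the skeleton's
`chiralPenaltyResponse_of_stubs` with `U := 0`). [folklore] -/
theorem penaltyResponseAt_zero_of_gibbsFloor {δ κ a M : ℝ} (hδ : 0 ≤ δ) (hκ : 0 < κ) (hM : 0 < M)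
    (hMκa : 2 * Real.log 4 ≤ M * κ * a)
    (hev : ∀ᶠ k : ℕ in atTop,
      let L : ℕ := 2 * (k + 1)
      let n : ℕ := ⌊(1 - δ) * (L : ℝ) ^ 2 / 2⌋₊
      let Hp := (hubbardTorus 2 L 1 0).toBlock
        (fun s => (upPart s).card = n ∧ (downPart s).card = n)
        (fun s => (upPart s).card = n ∧ (downPart s).card = n)
      let Qp := ((pairField dWaveFormFactor L)ᴴ * pairField dWaveFormFactor L).toBlock
        (fun s => (upPart s).card = n ∧ (downPart s).card = n)
        (fun s => (upPart s).card = n ∧ (downPart s).card = n)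
      a * (L : ℝ) ^ 4 ≤
        (Matrix.gibbsState (M * (L : ℝ) ^ 2) (Hp + ((κ / (L : ℝ) ^ 4 : ℝ) : ℂ) • Qp) Qp).re) :
    ∀ᶠ k : ℕ in atTop,
      a / 2 * κ ≤ Matrix.minEnergyOn (hubbardTorus 2 (2 * (k + 1)) 1 0 +
          ((κ / ((2 * (k + 1) : ℕ) : ℝ) ^ 4 : ℝ) : ℂ) •
            ((pairField dWaveFormFactor (2 * (k + 1)))ᴴ * pairField dWaveFormFactor (2 * (k + 1))))
          (szSector (2 * ⌊(1 - δ) * ((2 * (k + 1) : ℕ) : ℝ) ^ 2 / 2⌋₊) 0) -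
        Matrix.minEnergyOn (hubbardTorus 2 (2 * (k + 1)) 1 0)
          (szSector (2 * ⌊(1 - δ) * ((2 * (k + 1) : ℕ) : ℝ) ^ 2 / 2⌋₊) 0) := by
  filter_upwards [hev] with k hk
  dsimp only at hk
  have hLpos : (0 : ℝ) < ((2 * (k + 1) : ℕ) : ℝ) := by positivity
  -- the sector is not overfilled (`WcbcsSsbToTorusLRO.Negative.halfFilling_floor_le_sq`, in the import closure)
  have hn : ⌊(1 - δ) * (((2 * (k + 1) : ℕ)) : ℝ) ^ 2 / 2⌋₊ ≤ (2 * (k + 1)) ^ 2 :=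
    Summit.HubbardSuperconductivity.WcbcsSsbToTorusLRO.Negative.halfFilling_floor_le_sq _ hδ
  have hcardΛ : (((2 * (k + 1)) ^ 2 : ℕ) : ℝ) = (((2 * (k + 1) : ℕ)) : ℝ) ^ 2 := by
    push_cast; ring
  exact penaltyResponse_of_gibbsFloor (2 * (k + 1)) (hubbardTorus 2 (2 * (k + 1)) 1 0)
    ((pairField dWaveFormFactor (2 * (k + 1)))ᴴ * pairField dWaveFormFactor (2 * (k + 1)))
    (hubbardTorus_isHermitian (hamiltonian_isHermitian_and_commute_holds _) 1 0)
    (isHermitian_conjTranspose_mul_self _) hn hLpos hcardΛ hκ hM hMκa hk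

/-- **No Gibbs-penalty-floor constants at `U = 0`, at any doping `δ ≥ 0`.** For the free torus, no
`κ, a, M > 0` with `2 log 4 ≤ M κ a` satisfy the engine floor of line `SketchIdeator3` eventually along
`L = 2(k+1)`: otherwise `penaltyResponseAt_zero_of_gibbsFloor` gives the penalty response `(a/2)κ ≤ E_L(0;κ) - E_L(0;0)`
and `stub_penaltyResponseLRO 0 δ κ (a/2)` the summit matrix at `(0, δ)` (= `HasDWavePairFieldLROAt 0 δ` by
`Iff.rfl`), contradicting `not_hasDWavePairFieldLROAt_zero` (every free sector ground state has pair intensity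
`≤ 320 L²`). [folklore] -/
theorem stub_engineFalseAtZero {δ : ℝ} (hδ : 0 ≤ δ) :
    ¬ ∃ κ a M : ℝ, 0 < κ ∧ 0 < a ∧ 0 < M ∧ 2 * Real.log 4 ≤ M * κ * a ∧
        ∀ᶠ k : ℕ in atTop,
          let L : ℕ := 2 * (k + 1)
          let n : ℕ := ⌊(1 - δ) * (L : ℝ) ^ 2 / 2⌋₊
          let Hp := (hubbardTorus 2 L 1 0).toBlock
            (fun s => (upPart s).card = n ∧ (downPart s).card = n)
            (fun s => (upPart s).card = n ∧ (downPart s).card = n)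
          let Qp := ((pairField dWaveFormFactor L)ᴴ * pairField dWaveFormFactor L).toBlock
            (fun s => (upPart s).card = n ∧ (downPart s).card = n)
            (fun s => (upPart s).card = n ∧ (downPart s).card = n)
          a * (L : ℝ) ^ 4 ≤
            (Matrix.gibbsState (M * (L : ℝ) ^ 2) (Hp + ((κ / (L : ℝ) ^ 4 : ℝ) : ℂ) • Qp) Qp).re := by
  rintro ⟨κ, a, M, hκ, ha, hM, hMκa, hev⟩
  have hev' := penaltyResponseAt_zero_of_gibbsFloor hδ hκ hM hMκa hev
  have hmat : HasDWavePairFieldLROAt 0 δ :=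
    stub_penaltyResponseLRO 0 δ κ (a / 2) hκ (by positivity) hev'
  exact not_hasDWavePairFieldLROAt_zero hδ hmat

/-- **The `U = 0` analogue of `stub_gibbsPenaltyFloor` is false**: no doping of the window `[3/10, 12/25]`
carries Gibbs-penalty-floor constants for the free torus. The engine of line `SketchIdeator3` uses `0 < U`
quantitatively; its floor constant `a(U)` cannot stay bounded below as `U → 0⁺`
(cf. `cwThesis_false_uniformFloor`, `ringTraces_false_at_zero`). [folklore] -/
theorem gibbsPenaltyFloor_false_at_zero :
    ¬ ∃ δ ∈ Icc (3/10 : ℝ) (12/25), ∃ κ a M : ℝ, 0 < κ ∧ 0 < a ∧ 0 < M ∧ 2 * Real.log 4 ≤ M * κ * a ∧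
        ∀ᶠ k : ℕ in atTop,
          let L : ℕ := 2 * (k + 1)
          let n : ℕ := ⌊(1 - δ) * (L : ℝ) ^ 2 / 2⌋₊
          let Hp := (hubbardTorus 2 L 1 0).toBlock
            (fun s => (upPart s).card = n ∧ (downPart s).card = n)
            (fun s => (upPart s).card = n ∧ (downPart s).card = n)
          let Qp := ((pairField dWaveFormFactor L)ᴴ * pairField dWaveFormFactor L).toBlock
            (fun s => (upPart s).card = n ∧ (downPart s).card = n)
            (fun s => (upPart s).card = n ∧ (downPart s).card = n)
          a * (L : ℝ) ^ 4 ≤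
            (Matrix.gibbsState (M * (L : ℝ) ^ 2) (Hp + ((κ / (L : ℝ) ^ 4 : ℝ) : ℂ) • Qp) Qp).re := by
  rintro ⟨δ, hδ, h⟩
  exact stub_engineFalseAtZero (by linarith [hδ.1]) h

end Summit.HubbardSuperconductivity.CwThesis.Negative

end
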